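import Mathlib
import Summits.Ventures.PercRepro2.Defs
import Summits.Ventures.PercRepro2.Independence
import Summits.Ventures.PercRepro2.Harris
import Summits.Ventures.PercRepro2.Graph
import Summits.Ventures.PercRepro2.Exploration
import Summits.Ventures.PercRepro2.Events
import Summits.Ventures.PercRepro2.Statements
import Summits.Ventures.PercRepro2.FourFunctions
import Summits.Ventures.PercRepro2.Induced
import Summits.Ventures.PercRepro2.Frontier
import Summits.Ventures.PercRepro2.ObsIndependence
import Summits.Ventures.PercRepro2.BHK
import Summits.Ventures.PercRepro2.BHKEvents
import Summits.Ventures.PercRepro2.ClusterProperty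
import Summits.Ventures.PercRepro2.BHKPair
import Summits.Ventures.PercRepro2.CondAvoidPA
import Summits.Ventures.PercRepro2.CondAvoidZPA
import Summits.Ventures.PercRepro2.BoxUnionDefs
import Summits.Ventures.PercRepro2.BoxUnion
import Summits.Ventures.PercRepro2.BoxUnionPair
import Summits.Ventures.PercRepro2.PairTP2
import Summits.Ventures.PercRepro2.PairTP2Main
import Summits.Ventures.PercRepro2.UnionRowMech
import Summits.Ventures.PercRepro2.UnionRowMech2
import Summits.Ventures.PercRepro2.UnionRowMech3
import Summits.Ventures.PercRepro2.UnionRowMech4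
import Summits.Ventures.PercRepro2.UnionRowMech5
import Summits.Ventures.PercRepro2.UnionRowGrid
import Summits.Ventures.PercRepro2.UnionRowGrid2

/-!
# The double-exclusion two-status union row on every graph — no residual case
(blind cell PercRepro2, mine-1 g40; proofs/MINE1-UNIONROW2.md §8)

`UnionRowGrid2.double_exclusion_row` is the double-exclusion union row of row 2′CON-U
(`X = Y = {u, v}`) on every finite graph, for up-sets `A, B` of the status grid outside the two
residual membership patterns. `UnionRowMech5.double_exclusion_nonneg_all` removes that
hypothesis at the level of the 9-vector, from the seven positive-association facts that
`UnionRowGrid` / `UnionRowGrid2` already provide on every graph (`pa_Q`, `pa_R`, `pa_R'`,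
`pa_Ru`, `pa_Rv'`, `pa_R₀`, `pa_R₀'` — all instances of `CondAvoid.zpa_given_avoid`).

**THEOREM** (`double_exclusion_row_all`): for every finite graph, admissible weight vector and
ALL up-sets `A, B` of the status grid,
`Z·(Z·M(A∩B) − M(A)M(B)) − M(S,T)·Δ_A(S,T)Δ_B(S,T) − M(T,S)·Δ_A(T,S)Δ_B(T,S) ≥ 0`.
-/

namespace Summit.Ventures.PercRepro2

namespace UnionRowGrid

open Finset UnionRowMech
open scoped Classical

variable {V : Type*} {E : Type*} [Fintype V] [DecidableEq V] [Fintype E] [DecidableEq E]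
variable (ends : E → Sym2 V) (s t u v : V) {p : E → ℝ}

/-- **The double-exclusion union row on every graph, for all up-sets** — `double_exclusion_row`
without its residual hypothesis. -/
theorem double_exclusion_row_all (hp : IsProbVec p) {A B : Finset Grid} (hA : IsUp A)
    (hB : IsUp B) :
    0 ≤ total (gridMass ends s t u v p) *
        (total (gridMass ends s t u v p) * mass (gridMass ends s t u v p) (A ∩ B) -
          mass (gridMass ends s t u v p) A * mass (gridMass ends s t u v p) B) -
      gridMass ends s t u v p UnionRowMech.ST *
        (total (gridMass ends s t u v p) * (if UnionRowMech.ST ∈ A then 1 else 0) -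
          mass (gridMass ends s t u v p) A) *
        (total (gridMass ends s t u v p) * (if UnionRowMech.ST ∈ B then 1 else 0) -
          mass (gridMass ends s t u v p) B) -
      gridMass ends s t u v p TS *
        (total (gridMass ends s t u v p) * (if TS ∈ A then 1 else 0) -
          mass (gridMass ends s t u v p) A) *
        (total (gridMass ends s t u v p) * (if TS ∈ B then 1 else 0) -
          mass (gridMass ends s t u v p) B) :=
  double_exclusion_nonneg_all (gridMass_nonneg ends s t u v hp)
    (fun A B hA hB => pa_Q ends s t u v hp A B hA hB)
    (fun A B hA hB hAR hBR => pa_R ends s t u v hp A B hA hB hAR hBR)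
    (fun A B hA hB hAR hBR => pa_R' ends s t u v hp A B hA hB hAR hBR)
    (fun A B hA hB hAR hBR => pa_Ru ends s t u v hp A B hA hB hAR hBR)
    (fun A B hA hB hAR hBR => pa_Rv' ends s t u v hp A B hA hB hAR hBR)
    (fun A B hA hB hAR hBR => pa_R₀ ends s t u v hp A B hA hB hAR hBR)
    (fun A B hA hB hAR hBR => pa_R₀' ends s t u v hp A B hA hB hAR hBR) hA hB

end UnionRowGrid

end Summit.Ventures.PercRepro2
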